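import Summits.PneNP.PneNP.Theorems.UniformStreamUniformMagnificationVariants160473
import HarnessLib

/-!
# Route UniformStream, crux `UniformMagnification` (stmt-PneNP-16047), line `registered`,
# stub `stub_searchStream`, part B: the state maps of the one-pass compressor

Continuing part A (`UniformStreamUniformMagnificationVariants160473.lean`: the consistency relation
`SearchStream.Rel` and its search function), this file assembles — in the tree's `FP` algebra, for
ARBITRARY total maps `g` (a search function), `χ` (a live test) and `π` (a seed test) — the maps of
McKay–Murray–Williams' Algorithm 1 with block length `1`, and computes them on well-formed words:

* the state after a prefix `p` is `st = ⟨[m], body⟩`, `body = ⟨uv, ⟨Pw, Df⟩⟩`, with the live bit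
  `m`, `uv = ⟨u, v⟩` (`|u| = n`, `|v| = t`), the `(n+1)`-bit little-endian numeral `Pw` of the
  position `|p|`, and the padded program field `Df = ⟨D, 1^{2W - 2|D|}⟩` of FIXED length `2W + 2`
  (`W = SearchStream.Wp (|uv|)`); dead states are the empty word;
* `SearchStream.liveSt g` rebuilds a live state from a query `q = ⟨body, cb⟩`: new program `g q`
  re-padded (`dropSndFn`, `Plumb.polyFn`), position advanced by `|cb|` (`Brick.addFn`,
  `Brick.padTakeFn`), `SearchStream.core χ g` keeps it iff the live test `χ ⟨q, g q⟩` answers `1`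
  (`iteFn`);
* `SearchStream.delta χ g ⟨st, [b]⟩`: frozen on dead states (`PRelSigma.headT`), otherwise
  `core χ g ⟨body, [b]⟩`, wrapped in a final length guard (`lenLeFn`) making it non-lengthening on
  EVERY word (`SearchStream.length_delta_le`);
* `SearchStream.iota π χ g seed`: dead unless the seed test `π` answers `1`, otherwise the first
  search at position `0` with no row constraint (`SearchStream.ssQ0`); `SearchStream.Pow2L` is the
  seed test "`bin N = 0ⁿ1`" (`N` is a power of two), in `P`.

References: D. M. McKay, C. D. Murray, R. R. Williams, *Weak lower bounds on resource-bounded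
compression imply strong separations of complexity classes*, STOC 2019, §4 (Algorithm 1);
S. Arora, B. Barak, *Computational Complexity: A Modern Approach*, CUP 2009, §1.3, Thm. 2.18.
-/

namespace Summit.PneNP.PneNP.Cruxes.UniformMagnification.Birth

set_option linter.dupNamespace false -- `Summit.PneNP.PneNP.…`: summit = sub-problem (D-0017)

namespace SearchStream

open _root_.Computability
open Literature.Computability.Complexity Literature.Computability.MetaComplexity
open Literature.Computability.Complexity.Brick

-- BEGIN BODY

/-! ### The live state built from a query `q = ⟨⟨uv, ⟨Pw, Df⟩⟩, cb⟩` -/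

/-- `pwQ q = Pw`, the position field of a query. [folklore] -/
def pwQ : List Bool → List Bool := fstP ∘ sndP ∘ fstP

/-- `pwQ ∈ FP`. [folklore] -/
theorem pwQ_mem_FP : pwQ ∈ FP := comp_mem_FP fstP_mem_FP (comp_mem_FP sndP_mem_FP fstP_mem_FP)

/-- `pwQ` reads `Pw`. [folklore] -/
@[simp] theorem pwQ_apply (uv Pw Df cb : List Bool) :
    pwQ (boolPair (boolPair uv (boolPair Pw Df)) cb) = Pw := by
  simp [pwQ]

/-- **The next position field**: the numeral of `val Pw + val 1^{|cb|}` cut/padded to `|Pw|` bits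
(`Brick.addFn`, `Brick.padTakeFn`; `cb = ε` keeps the position, `cb = [b]` advances it). [folklore] -/
noncomputable def nextPw : List Bool → List Bool :=
  fstP ∘ padTakeFn ∘ pairFn pwQ (addFn ∘ pairFn pwQ (onesFn ∘ sndP))

/-- `nextPw ∈ FP`. [cite: AroraBarakCC2009, §1.3] -/
theorem nextPw_mem_FP : nextPw ∈ FP :=
  comp_mem_FP fstP_mem_FP (comp_mem_FP padTakeFn_mem_FP (pairFn_mem_FP pwQ_mem_FP
    (comp_mem_FP addFn_mem_FP (pairFn_mem_FP pwQ_mem_FP (comp_mem_FP onesFn_mem_FP sndP_mem_FP)))))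

/-- Value of `nextPw` on a query. [folklore] -/
theorem nextPw_apply (uv Pw Df cb : List Bool) :
    nextPw (boolPair (boolPair uv (boolPair Pw Df)) cb) =
      List.takeD Pw.length (encodeNat (bitsToNat Pw + bitsToNat (onesFn cb))) false := by
  simp [nextPw]

/-- **The new program field** `⟨g q, 1^{2W(|uv|) - 2|g q|}⟩` (`Plumb.polyFn (2W)` on `uv`, then
`dropSndFn (2X)`): of length exactly `2W + 2` whenever `|g q| ≤ W`. [folklore] -/
noncomputable def newDf (g : List Bool → List Bool) : List Bool → List Bool :=
  dropSndFn (2 * Polynomial.X) ∘ pairFn g (Plumb.polyFn (2 * Wp) ∘ fstP ∘ fstP)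

/-- `newDf g ∈ FP` for `g ∈ FP`. [cite: AroraBarakCC2009, §1.3] -/
theorem newDf_mem_FP {g : List Bool → List Bool} (hg : g ∈ FP) : newDf g ∈ FP :=
  comp_mem_FP (dropSndFn_mem_FP _) (pairFn_mem_FP hg (comp_mem_FP (Plumb.polyFn_mem_FP _)
    (comp_mem_FP fstP_mem_FP fstP_mem_FP)))

/-- Value of `newDf g` on a query `q` with `fstP (fstP q) = uv`. [folklore] -/
theorem newDf_apply (g : List Bool → List Bool) (uv rest cb : List Bool) :
    newDf g (boolPair (boolPair uv rest) cb) =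
      boolPair (g (boolPair (boolPair uv rest) cb))
        (List.replicate (2 * Wp.eval uv.length - 2 * (g (boolPair (boolPair uv rest) cb)).length) true) := by
  simp [newDf, dropSndFn_boolPair, ones]

/-- **The live state** `⟨[1], ⟨uv, ⟨nextPw q, newDf g q⟩⟩⟩` built from a query `q`. [folklore] -/
noncomputable def liveSt (g : List Bool → List Bool) : List Bool → List Bool :=
  pairFn (fun _ => [true]) (pairFn (fstP ∘ fstP) (pairFn nextPw (newDf g)))

/-- `liveSt g ∈ FP` for `g ∈ FP`. [cite: AroraBarakCC2009, §1.3] -/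
theorem liveSt_mem_FP {g : List Bool → List Bool} (hg : g ∈ FP) : liveSt g ∈ FP :=
  pairFn_mem_FP (const_mem_FP _) (pairFn_mem_FP (comp_mem_FP fstP_mem_FP fstP_mem_FP)
    (pairFn_mem_FP nextPw_mem_FP (newDf_mem_FP hg)))

/-- Value of `liveSt g` on a query. [folklore] -/
theorem liveSt_apply (g : List Bool → List Bool) (uv Pw Df cb : List Bool) :
    liveSt g (boolPair (boolPair uv (boolPair Pw Df)) cb) =
      boolPair [true] (boolPair uv (boolPair
        (List.takeD Pw.length (encodeNat (bitsToNat Pw + bitsToNat (onesFn cb))) false)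
        (boolPair (g (boolPair (boolPair uv (boolPair Pw Df)) cb))
          (List.replicate (2 * Wp.eval uv.length -
            2 * (g (boolPair (boolPair uv (boolPair Pw Df)) cb)).length) true)))) := by
  rw [liveSt, pairFn_apply, pairFn_apply, pairFn_apply, nextPw_apply, newDf_apply]
  simp

/-- **The core step**: search `D' = g q`, test `⟨q, D'⟩` with `χ`, and return the live state or the
dead word `ε` (`iteFn`). [cite: MckayMurrayWilliams2019, §4 (Algorithm 1)] -/
noncomputable def core (χ g : List Bool → List Bool) : List Bool → List Bool :=
  iteFn (χ ∘ pairFn id g) (liveSt g) (fun _ => [])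

/-- `core χ g ∈ FP` for `χ, g ∈ FP`. [cite: AroraBarakCC2009, §1.3] -/
theorem core_mem_FP {χ g : List Bool → List Bool} (hχ : χ ∈ FP) (hg : g ∈ FP) : core χ g ∈ FP :=
  iteFn_mem_FP (comp_mem_FP hχ (pairFn_mem_FP OracleCompose.id_mem_FP hg)) (liveSt_mem_FP hg)
    (const_mem_FP _)

/-- Value of the core step when the live test answers the bit `b`. [folklore] -/
theorem core_apply {χ g : List Bool → List Bool} {q : List Bool} {b : Bool}
    (h : χ (boolPair q (g q)) = [b]) : core χ g q = if b then liveSt g q else [] := by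
  rw [core, iteFn_apply (b := b) (by simpa using h)]

/-! ### The update map -/

/-- `delta0 χ g ⟨st, cb⟩ = core χ g ⟨sndP st, cb⟩` (the query is the body of the state and the new
bit). [folklore] -/
noncomputable def delta0 (χ g : List Bool → List Bool) : List Bool → List Bool :=
  core χ g ∘ pairFn (sndP ∘ fstP) sndP

/-- `delta0 χ g ∈ FP`. [cite: AroraBarakCC2009, §1.3] -/
theorem delta0_mem_FP {χ g : List Bool → List Bool} (hχ : χ ∈ FP) (hg : g ∈ FP) : delta0 χ g ∈ FP :=
  comp_mem_FP (core_mem_FP hχ hg) (pairFn_mem_FP (comp_mem_FP sndP_mem_FP fstP_mem_FP) sndP_mem_FP)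

/-- Value of `delta0`. [folklore] -/
theorem delta0_apply (χ g : List Bool → List Bool) (st cb : List Bool) :
    delta0 χ g (boolPair st cb) = core χ g (boolPair (sndP st) cb) := by
  simp [delta0]

/-- `delta1 χ g ⟨st, cb⟩`: a dead state (head bit not `1`) is frozen, a live one is updated by
`delta0` (`iteFn` on `PRelSigma.headT`). [cite: MckayMurrayWilliams2019, §4 (Algorithm 1)] -/
noncomputable def delta1 (χ g : List Bool → List Bool) : List Bool → List Bool :=
  iteFn ((PRelSigma.headT true).eval ∘ fstP) (delta0 χ g) fstP

/-- `delta1 χ g ∈ FP`. [cite: AroraBarakCC2009, §1.3] -/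
theorem delta1_mem_FP {χ g : List Bool → List Bool} (hχ : χ ∈ FP) (hg : g ∈ FP) : delta1 χ g ∈ FP :=
  iteFn_mem_FP (comp_mem_FP (PRelSigma.headT true).polyTimeComputable_eval fstP_mem_FP)
    (delta0_mem_FP hχ hg) fstP_mem_FP

/-- Value of `delta1`. [folklore] -/
theorem delta1_apply (χ g : List Bool → List Bool) (st cb : List Bool) :
    delta1 χ g (boolPair st cb) =
      if st.head? = some true then core χ g (boolPair (sndP st) cb) else st := by
  rw [delta1, iteFn_apply (b := decide (st.head? = some true))
    (by simp [PRelSigma.headT_eval]), delta0_apply, fstP_boolPair]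
  by_cases h : st.head? = some true
  · rw [if_pos h, if_pos (decide_eq_true h)]
  · rw [if_neg h, if_neg (by simpa using h)]

/-- **The update map** `delta χ g`: `delta1` under a final length guard — the new state is kept
only if it is not longer than the old one (`lenLeFn X` on `⟨st, delta1 ⟨st, cb⟩⟩`).
[cite: MckayMurrayWilliams2019, §4 (Algorithm 1)] -/
noncomputable def delta (χ g : List Bool → List Bool) : List Bool → List Bool :=
  iteFn (lenLeFn Polynomial.X ∘ pairFn fstP (delta1 χ g)) (delta1 χ g) fstP

/-- **`delta χ g ∈ FP`** for `χ, g ∈ FP`. [cite: AroraBarakCC2009, §1.3] -/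
theorem delta_mem_FP {χ g : List Bool → List Bool} (hχ : χ ∈ FP) (hg : g ∈ FP) : delta χ g ∈ FP :=
  iteFn_mem_FP (comp_mem_FP (lenLeFn_mem_FP _) (pairFn_mem_FP fstP_mem_FP (delta1_mem_FP hχ hg)))
    (delta1_mem_FP hχ hg) fstP_mem_FP

/-- Value of `delta`. [folklore] -/
theorem delta_apply (χ g : List Bool → List Bool) (st cb : List Bool) :
    delta χ g (boolPair st cb) =
      if (delta1 χ g (boolPair st cb)).length ≤ st.length then delta1 χ g (boolPair st cb) else st := by
  rw [delta, iteFn_apply (b := decide ((delta1 χ g (boolPair st cb)).length ≤ st.length))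
    (by simp [lenLeFn_boolPair]), fstP_boolPair]
  by_cases h : (delta1 χ g (boolPair st cb)).length ≤ st.length
  · rw [if_pos h, if_pos (decide_eq_true h)]
  · rw [if_neg h, if_neg (by simpa using h)]

/-- **The update map never lengthens a state**, on every word `⟨st, cb⟩`. [folklore] -/
theorem length_delta_le (χ g : List Bool → List Bool) (st cb : List Bool) :
    (delta χ g (boolPair st cb)).length ≤ st.length := by
  rw [delta_apply]
  by_cases h : (delta1 χ g (boolPair st cb)).length ≤ st.length
  · rwa [if_pos h]
  · rw [if_neg h]

/-- The guard is transparent where `delta1` does not lengthen. [folklore] -/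
theorem delta_eq_delta1 (χ g : List Bool → List Bool) (st cb : List Bool)
    (h : (delta1 χ g (boolPair st cb)).length ≤ st.length) :
    delta χ g (boolPair st cb) = delta1 χ g (boolPair st cb) := by
  rw [delta_apply, if_pos h]

/-- On the dead word the update is the dead word. [folklore] -/
theorem delta_nil (χ g : List Bool → List Bool) (cb : List Bool) : delta χ g (boolPair [] cb) = [] := by
  have h1 : delta1 χ g (boolPair [] cb) = [] := by rw [delta1_apply]; rfl
  rw [delta_eq_delta1 χ g [] cb (by rw [h1]), h1]

/-- On a live state `⟨[1], body⟩` the update is the guarded core step on `⟨body, cb⟩`. [folklore] -/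
theorem delta1_live (χ g : List Bool → List Bool) (body cb : List Bool) :
    delta1 χ g (boolPair (boolPair [true] body) cb) = core χ g (boolPair body cb) := by
  rw [delta1_apply, sndP_boolPair, if_pos (show (boolPair [true] body).head? = some true from rfl)]

/-! ### The initial map -/

/-- **The seed test** "`N` is a power of two": on a seed `⟨⟨u, v⟩, x⟩` (`x = bin N`, `|u| = n`),
`x = 0ⁿ1`. [folklore] -/
def Pow2L : Language Bool :=
  {z | sndP z = Kannan.zerosFn (fstP (fstP z)) ++ [true]}

/-- `Pow2L ∈ P` (an equality of two `FP` images). [cite: AroraBarakCC2009, §1.3] -/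
theorem Pow2L_mem_P : Pow2L ∈ Classes.P :=
  setOf_apply_eq_apply_mem_P sndP_mem_FP (append_mem_FP
    (comp_mem_FP Kannan.zerosFn_mem_FP (comp_mem_FP fstP_mem_FP fstP_mem_FP)) (const_mem_FP [true]))

/-- Reading the seed test. [folklore] -/
theorem boolPair_mem_Pow2L_iff (u v x : List Bool) :
    boolPair (boolPair u v) x ∈ Pow2L ↔ x = List.replicate u.length false ++ [true] := by
  show sndP _ = _ ↔ _
  simp

/-- **The first query** `⟨⟨uv, ⟨0^{|u|+1}, ⟨ε, ε⟩⟩⟩, ε⟩` built from a seed `⟨uv, x⟩`: position `0`,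
an irrelevant program field, no row constraint. [folklore] -/
noncomputable def ssQ0 : List Bool → List Bool :=
  pairFn (pairFn fstP (pairFn (List.cons false ∘ Kannan.zerosFn ∘ fstP ∘ fstP)
    (fun _ => boolPair [] []))) (fun _ => [])

/-- `ssQ0 ∈ FP`. [cite: AroraBarakCC2009, §1.3] -/
theorem ssQ0_mem_FP : ssQ0 ∈ FP :=
  pairFn_mem_FP (pairFn_mem_FP fstP_mem_FP (pairFn_mem_FP (comp_mem_FP (cons_mem_FP false)
    (comp_mem_FP Kannan.zerosFn_mem_FP (comp_mem_FP fstP_mem_FP fstP_mem_FP))) (const_mem_FP _)))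
    (const_mem_FP _)

/-- Value of the first query on a seed `⟨⟨u, v⟩, x⟩`. [folklore] -/
theorem ssQ0_apply (u v x : List Bool) :
    ssQ0 (boolPair (boolPair u v) x) =
      boolPair (boolPair (boolPair u v) (boolPair (List.replicate (u.length + 1) false) (boolPair [] [])))
        [] := by
  simp [ssQ0, List.replicate_succ]

/-- **The initial map** `iota π χ g`: the dead word unless the seed test `π` answers `1`, otherwise
the core step on the first query. [cite: MckayMurrayWilliams2019, §4 (Algorithm 1)] -/
noncomputable def iota (π χ g : List Bool → List Bool) : List Bool → List Bool :=
  iteFn π (core χ g ∘ ssQ0) (fun _ => [])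

/-- **`iota π χ g ∈ FP`** for `π, χ, g ∈ FP`. [cite: AroraBarakCC2009, §1.3] -/
theorem iota_mem_FP {π χ g : List Bool → List Bool} (hπ : π ∈ FP) (hχ : χ ∈ FP) (hg : g ∈ FP) :
    iota π χ g ∈ FP :=
  iteFn_mem_FP hπ (comp_mem_FP (core_mem_FP hχ hg) ssQ0_mem_FP) (const_mem_FP _)

/-- Value of the initial map when the seed test answers the bit `b`. [folklore] -/
theorem iota_apply {π : List Bool → List Bool} (χ g : List Bool → List Bool) {seed : List Bool}
    {b : Bool} (h : π seed = [b]) : iota π χ g seed = if b then core χ g (ssQ0 seed) else [] := by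
  rw [iota, iteFn_apply h]
  rfl

/-! ### Numerals and rows -/

/-- The low `k` symbols of a numeral, padded with zeros, carry its value modulo `2^k`. [folklore] -/
theorem bitsToNat_takeD (l : List Bool) (k : ℕ) : bitsToNat (l.takeD k false) = bitsToNat l % 2 ^ k := by
  refine Nat.eq_of_testBit_eq fun j => ?_
  rw [Nat.testBit_mod_two_pow, Com.testBit_bitsToNat, Com.testBit_bitsToNat]
  by_cases hj : j < k
  · rw [getD_takeD k l j hj]
    simp [hj]
  · rw [List.getD_eq_default _ _ (by rw [List.takeD_length]; omega)]
    simp [hj]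

/-- The point `lowBits k i`, listed, is a numeral of value `i mod 2^k`. [folklore] -/
theorem bitsToNat_ofFn_lowBits (k i : ℕ) :
    bitsToNat (List.ofFn (MCSPVerif.lowBits k i)) = i % 2 ^ k := by
  rw [← MCSPVerif.takeD_encodeNat, bitsToNat_takeD, bitsToNat_encodeNat]

/-- A word lists the point addressed by its own value (`MCSPVerif.lowBits_apply`,
`Com.testBit_bitsToNat`). [folklore] -/
theorem ofFn_lowBits_bitsToNat (w : List Bool) :
    List.ofFn (MCSPVerif.lowBits w.length (bitsToNat w)) = w := by
  apply List.ext_getElem (by simp)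
  intro j h1 h2
  rw [List.getElem_ofFn, MCSPVerif.lowBits_apply, Com.testBit_bitsToNat, List.getD_eq_getElem?_getD,
    List.getElem?_eq_getElem h2, Option.getD_some]

/-- `val 1^{|[b]|} = 1`. [folklore] -/
@[simp] theorem bitsToNat_onesFn_singleton (b : Bool) : bitsToNat (onesFn [b]) = 1 := by
  simp [onesFn, OracleCompose.unaryEncodeNat_eq_replicate]

/-- `val 1^{|ε|} = 0`. [folklore] -/
@[simp] theorem bitsToNat_onesFn_nil : bitsToNat (onesFn []) = 0 := by
  simp [onesFn, OracleCompose.unaryEncodeNat_eq_replicate]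

/-! ### The canonical live state -/

/-- **The canonical live state** at parameters `u, v` (`n = |u|`, `t = |v|`) after a prefix of
length `P` with current program `D`:
`⟨[1], ⟨⟨u, v⟩, ⟨takeD (n+1) (bin P), ⟨D, 1^{2W - 2|D|}⟩⟩⟩⟩`, `W = Wp (|⟨u, v⟩|)`.
[cite: MckayMurrayWilliams2019, §4 (Algorithm 1)] -/
noncomputable def liveWord (u v : List Bool) (P : ℕ) (D : List Bool) : List Bool :=
  boolPair [true] (boolPair (boolPair u v) (boolPair ((encodeNat P).takeD (u.length + 1) false)
    (boolPair D (List.replicate (2 * Wp.eval (boolPair u v).length - 2 * D.length) true))))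

/-- **Live states have a fixed length** (as long as `|D| ≤ W`). [folklore] -/
theorem length_liveWord (u v : List Bool) (P : ℕ) (D : List Bool)
    (hD : D.length ≤ Wp.eval (boolPair u v).length) :
    (liveWord u v P D).length =
      2 * (boolPair u v).length + 2 * u.length + 2 * Wp.eval (boolPair u v).length + 12 := by
  simp only [liveWord, length_boolPair, List.takeD_length, List.length_replicate, List.length_cons,
    List.length_nil] at hD ⊢
  omega

/-- Live states start with the bit `1`. [folklore] -/
theorem head?_liveWord (u v : List Bool) (P : ℕ) (D : List Bool) : (liveWord u v P D).head? = some true :=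
  rfl

/-- The body of a live state. [folklore] -/
theorem sndP_liveWord (u v : List Bool) (P : ℕ) (D : List Bool) :
    sndP (liveWord u v P D) = boolPair (boolPair u v) (boolPair ((encodeNat P).takeD (u.length + 1) false)
      (boolPair D (List.replicate (2 * Wp.eval (boolPair u v).length - 2 * D.length) true))) :=
  sndP_boolPair _ _

/-- **The live state built from the query of a live state advances the position**: on
`q = ⟨body, [b]⟩` with `body` the body of `liveWord u v P D` and `P + 1 < 2^{n+1}`,
`liveSt g q = liveWord u v (P + 1) (g q)`. [folklore] -/
theorem liveSt_step (g : List Bool → List Bool) (u v : List Bool) (P : ℕ) (D : List Bool) (b : Bool)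
    (hP : P + 1 < 2 ^ (u.length + 1)) :
    liveSt g (boolPair (sndP (liveWord u v P D)) [b]) =
      liveWord u v (P + 1) (g (boolPair (sndP (liveWord u v P D)) [b])) := by
  rw [sndP_liveWord, liveSt_apply, liveWord, List.takeD_length, bitsToNat_takeD, bitsToNat_encodeNat,
    Nat.mod_eq_of_lt (by omega), bitsToNat_onesFn_singleton]

/-- **The live state built from the first query is at position `0`**:
`liveSt g (ssQ0 ⟨⟨u, v⟩, x⟩) = liveWord u v 0 (g (ssQ0 ⟨⟨u, v⟩, x⟩))`. [folklore] -/
theorem liveSt_init (g : List Bool → List Bool) (u v x : List Bool) :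
    liveSt g (ssQ0 (boolPair (boolPair u v) x)) = liveWord u v 0 (g (ssQ0 (boolPair (boolPair u v) x))) := by
  rw [ssQ0_apply, liveSt_apply, liveWord, List.length_replicate, bitsToNat_replicate_false,
    bitsToNat_onesFn_nil, Nat.zero_add, show encodeNat 0 = [] from rfl, List.takeD_nil]

end SearchStream

end Summit.PneNP.PneNP.Cruxes.UniformMagnification.Birth
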